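import Literature.NumberTheory.EllipticCurves.ModularSymbolsProofs
import Literature.NumberTheory.EllipticCurves.WeierstrassPDiffEqProofs
import HarnessLib

/-!
# The function `℘_Λ(2πi ∫_{i∞}^τ f)` on the upper half-plane

Topic `NumberTheory/EllipticCurves`; a proofs-only file (theorems only, no definitions, no named
facts). Let `f ∈ S₂(Γ₀(N))`, let `u(τ) = 2πi ∫_{i∞}^τ f` be its Eichler integral
(`eichlerIntegral f`, `ModularSymbols.lean`) and let `Λ` be a lattice (a period pair `L`)
containing the period lattice `Λ_f` of `f` (`periodLattice f`; equality in the application).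
Since `u(γτ) − u(τ) ∈ Λ_f` for `γ ∈ Γ₀(N)` (the tree's theorem `eichlerIntegral_gamma_smul_holds`,
Manin 1972, Prop. 1.4; Cremona 1997, §2.10), the meromorphic function

  `x(τ) = ℘_Λ(u(τ))`

is `Γ₀(N)`-invariant: it is the `x`-coordinate of the **analytic modular parametrisation**
`X₀(N) → ℂ/Λ_f ≅ E_f(ℂ)` of the complex torus `E_f = ℂ/Λ_f` (Cremona 1997, §2.6, §2.10:
"`E_f = ℂ/Λ_f` is an elliptic curve, the modular elliptic curve attached to `f`"; Knapp 1993,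
Thm. 11.74 (d); Shimura 1971, Thm. 7.14). This file records its elementary analytic properties
on the complex variable `z` (through Mathlib's `UpperHalfPlane.ofComplex`), as inputs for
recognising the curve `ℂ/Λ_f` over `ℚ`:

* `weierstrassP_eichlerIntegral_gamma_smul` — `℘_Λ(u(γτ)) = ℘_Λ(u(τ))` for `γ ∈ Γ₀(N)`;
* `differentiableOn_eichlerIntegral_comp_ofComplex`, `analyticAt_eichlerIntegral_comp_ofComplex`,
  `deriv_eichlerIntegral_comp_ofComplex` — `u` is holomorphic on `{im z > 0}` with
  `u′ = 2πi f` (the tree's `hasDerivAt_eichlerIntegral`, Cremona §2.10);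
* `not_eventually_const_eichlerIntegral` — for `f ≠ 0`, `u` is nowhere locally constant
  (identity theorem on `ℍ`, Mathlib `UpperHalfPlane.eq_zero_of_frequently`);
* `countable_setOf_eichlerIntegral_mem_lattice` — for `f ≠ 0` the pole set
  `{im z > 0, u(z) ∈ Λ}` of `x` is countable, and `isOpen_setOf_eichlerIntegral_notMem_lattice`
  — its complement in the half-plane is open;
* `deriv_weierstrassP_eichlerIntegral_sq` — **the differential equation**
  `x′(z)² = u′(z)² (4x(z)³ − g₂x(z) − g₃)` off the poles (`u′ = 2πi f`), i.e.
  `(θx)² = f² (4x³ − g₂x − g₃)` with `θ = (2πi)⁻¹ d/dz`: the pull-back of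
  `(dX/Y)` on `Y² = 4X³ − g₂X − g₃` along `τ ↦ (℘(u), ℘′(u))` is `du = 2πi f(τ)dτ`
  (Cremona 1997, §2.10, the modular parametrisation; Silverman AEC VI.3).

## References

* J. E. Cremona, *Algorithms for modular elliptic curves*, 2nd ed., CUP 1997: §2.6, §2.10
  (Prop. 2.1.1, (2.10.2)–(2.10.3)). [CremonaAlgorithms1997]
* Ju. I. Manin, *Parabolic points and zeta functions of modular curves*, Izv. AN SSSR 36 (1972):
  Prop. 1.4, §1.5. [Manin1972]
* A. W. Knapp, *Elliptic Curves*, Princeton 1993: Thm. 11.74 (d). [Knapp1993]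
-/

noncomputable section

open Complex Filter Topology Set UpperHalfPlane
open scoped MatrixGroups ModularForm Real PeriodPair

open Literature.NumberTheory.EllipticCurves

namespace Literature.NumberTheory.EllipticCurves.ModularForms

open CongruenceSubgroup

variable {N : ℕ} [NeZero N] (f : CuspForm (Gamma0 N) 2) (L : PeriodPair)

/-! ### `Γ₀(N)`-invariance -/

/-- **`℘_Λ(2πi∫f)` is `Γ₀(N)`-invariant** when `Λ ⊇ Λ_f`: `u(γτ) = u(τ) + λ_γ` with
`λ_γ = {∞, γ∞}_f ∈ Λ_f ⊆ Λ` (`eichlerIntegral_gamma_smul_holds`, Manin 1972, Prop. 1.4) and `℘_Λ`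
is `Λ`-periodic. [cite: Manin1972, Prop. 1.4] -/
theorem weierstrassP_eichlerIntegral_gamma_smul (hΛ : ∀ x ∈ periodLattice f, x ∈ L.lattice)
    (γ : Gamma0 N) (τ : ℍ) :
    ℘[L] (eichlerIntegral f ((γ : SL(2, ℤ)) • τ)) = ℘[L] (eichlerIntegral f τ) := by
  have hmem : eichlerIntegral f ((γ : SL(2, ℤ)) • τ) - eichlerIntegral f τ ∈ L.lattice :=
    hΛ _ (eichlerIntegral_gamma_smul_holds f γ τ)
  have := L.weierstrassP_add_coe (eichlerIntegral f τ) ⟨_, hmem⟩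
  rwa [add_sub_cancel] at this

/-! ### Holomorphy of the Eichler integral in the complex variable -/

/-- The upper half-plane `{im z > 0} ⊆ ℂ` is convex. [folklore] -/
theorem convex_setOf_im_pos : Convex ℝ {z : ℂ | 0 < z.im} := by
  have : {z : ℂ | 0 < z.im} = Complex.imLm ⁻¹' Ioi 0 := by ext z; simp
  rw [this]
  exact (convex_Ioi 0).linear_preimage _

/-- The Eichler integral is holomorphic on `{im z > 0}` as a function of the complex variable
(`hasDerivAt_eichlerIntegral`, Cremona §2.10). [cite: CremonaAlgorithms1997, §2.10] -/
theorem differentiableOn_eichlerIntegral_comp_ofComplex :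
    DifferentiableOn ℂ (fun w : ℂ ↦ eichlerIntegral f (ofComplex w)) {z : ℂ | 0 < z.im} :=
  fun _ hz ↦ (hasDerivAt_eichlerIntegral f hz).differentiableAt.differentiableWithinAt

/-- The Eichler integral is analytic at every point of the upper half-plane. [folklore] -/
theorem analyticAt_eichlerIntegral_comp_ofComplex {z : ℂ} (hz : 0 < z.im) :
    AnalyticAt ℂ (fun w : ℂ ↦ eichlerIntegral f (ofComplex w)) z :=
  (differentiableOn_eichlerIntegral_comp_ofComplex f).analyticAt (isOpen_upperHalfPlaneSet.mem_nhds hz)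

/-- `d/dz (2πi ∫_{i∞}^z f) = 2πi f(z)` (`deriv` form of `hasDerivAt_eichlerIntegral`).
[cite: CremonaAlgorithms1997, §2.10] -/
theorem deriv_eichlerIntegral_comp_ofComplex {z : ℂ} (hz : 0 < z.im) :
    deriv (fun w : ℂ ↦ eichlerIntegral f (ofComplex w)) z = 2 * π * Complex.I * f (ofComplex z) :=
  (hasDerivAt_eichlerIntegral f hz).deriv

/-- For `f ≠ 0` the Eichler integral is nowhere locally constant: if `u` were constant near `z`,
then `2πi f = u′ = 0` near `z` and `f = 0` by the identity theorem on `ℍ`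
(Mathlib `UpperHalfPlane.eq_zero_of_frequently`). [folklore] -/
theorem not_eventually_const_eichlerIntegral (hf : f ≠ 0) {z : ℂ} (hz : 0 < z.im) (a : ℂ) :
    ¬ ∀ᶠ w in 𝓝 z, eichlerIntegral f (ofComplex w) = a := by
  intro h
  apply hf
  -- `f ∘ ofComplex = 0` near `z`
  have hderiv : ∀ᶠ w in 𝓝 z, 2 * π * Complex.I * f (ofComplex w) = 0 := by
    have hz' : ∀ᶠ w in 𝓝 z, 0 < w.im := isOpen_upperHalfPlaneSet.mem_nhds hz
    filter_upwards [hz', h.eventually_nhds] with w hw hw'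
    rw [← deriv_eichlerIntegral_comp_ofComplex f hw]
    have : deriv (fun w : ℂ ↦ eichlerIntegral f (ofComplex w)) w = deriv (fun _ : ℂ ↦ a) w :=
      Filter.EventuallyEq.deriv_eq hw'
    rw [this, deriv_const]
  have h2 : ∀ᶠ w in 𝓝 z, f (ofComplex w) = 0 := by
    filter_upwards [hderiv] with w hw
    have h0 : (2 * π * Complex.I : ℂ) ≠ 0 := by simp [Real.pi_ne_zero, Complex.I_ne_zero]
    exact (mul_eq_zero.mp hw).resolve_left h0
  -- transfer to `ℍ` and apply the identity theorem
  set τ : ℍ := ⟨z, hz⟩ with hτ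
  have h3 : ∀ᶠ w in 𝓝 τ, f w = 0 := by
    have hcont : Tendsto ((↑) : ℍ → ℂ) (𝓝 τ) (𝓝 z) := UpperHalfPlane.continuous_coe.tendsto τ
    filter_upwards [hcont.eventually h2] with w hw
    simpa [ofComplex_apply] using hw
  apply DFunLike.ext'
  exact UpperHalfPlane.eq_zero_of_frequently (CuspFormClass.holo f)
    ((h3.filter_mono nhdsWithin_le_nhds).frequently)

/-! ### The pole set of `℘_Λ(u)` -/

/-- For `f ≠ 0` and a period pair `L`, the set of `z` in the upper half-plane with `u(z) ∈ Λ`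
(the poles of `℘_Λ ∘ u`) is countable: each fibre `u = λ` is countable (`u` is not constant on
the connected half-plane) and `Λ` is countable. [folklore] -/
theorem countable_setOf_eichlerIntegral_mem_lattice (hf : f ≠ 0) :
    {z : ℂ | 0 < z.im ∧ eichlerIntegral f (ofComplex z) ∈ L.lattice}.Countable := by
  have hconn : IsConnected {z : ℂ | 0 < z.im} := by
    refine ⟨⟨Complex.I, by simp⟩, ?_⟩
    simpa using isPreconnected_diff_of_countable (T := ∅) convex_setOf_im_pos isOpen_upperHalfPlaneSet
      countable_empty
  have han : AnalyticOnNhd ℂ (fun w : ℂ ↦ eichlerIntegral f (ofComplex w)) {z : ℂ | 0 < z.im} :=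
    fun z hz ↦ analyticAt_eichlerIntegral_comp_ofComplex f hz
  have heq : {z : ℂ | 0 < z.im ∧ eichlerIntegral f (ofComplex z) ∈ L.lattice} =
      ⋃ l ∈ (L.lattice : Set ℂ),
        ({z : ℂ | 0 < z.im} ∩ (fun w : ℂ ↦ eichlerIntegral f (ofComplex w)) ⁻¹' {l}) := by
    ext z
    simp only [mem_setOf_eq, mem_iUnion, mem_inter_iff, mem_preimage, mem_singleton_iff,
      SetLike.mem_coe, exists_prop]
    constructor
    · rintro ⟨hz, hl⟩
      exact ⟨_, hl, hz, rfl⟩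
    · rintro ⟨l, hl, hz, rfl⟩
      exact ⟨hz, hl⟩
  rw [heq]
  refine L.countable_lattice.biUnion fun l _ ↦ ?_
  -- a point where `u ≠ l`: otherwise `u` would be constant near `I`
  by_cases hex : ∃ z : ℂ, 0 < z.im ∧ eichlerIntegral f (ofComplex z) ≠ l
  · obtain ⟨z₁, hz₁, hne⟩ := hex
    exact countable_inter_preimage_singleton_of_analyticOnNhd han hconn hz₁ hne
  · simp only [not_exists, not_and, not_not] at hex
    exfalso
    apply not_eventually_const_eichlerIntegral f hf (z := Complex.I) (by simp) l
    filter_upwards [isOpen_upperHalfPlaneSet.mem_nhds (show (0 : ℝ) < Complex.I.im by simp)] with w hw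
    exact hex w hw

/-- The complement of the pole set in the half-plane, `{im z > 0, u(z) ∉ Λ}`, is open
(`Λ` is closed and `u` continuous). [folklore] -/
theorem isOpen_setOf_eichlerIntegral_notMem_lattice :
    IsOpen {z : ℂ | 0 < z.im ∧ eichlerIntegral f (ofComplex z) ∉ L.lattice} :=
  (differentiableOn_eichlerIntegral_comp_ofComplex f).continuousOn.isOpen_inter_preimage
    isOpen_upperHalfPlaneSet L.isClosed_lattice.isOpen_compl

omit [NeZero N] in
/-- The half-plane minus the open set `{u ∉ Λ}` is the (countable) pole set. [folklore] -/
theorem setOf_im_pos_diff_eq :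
    {z : ℂ | 0 < z.im} \ {z : ℂ | 0 < z.im ∧ eichlerIntegral f (ofComplex z) ∉ L.lattice} =
      {z : ℂ | 0 < z.im ∧ eichlerIntegral f (ofComplex z) ∈ L.lattice} := by
  ext z
  constructor
  · rintro ⟨hz, h⟩
    refine ⟨hz, ?_⟩
    by_contra hnot
    exact h ⟨hz, hnot⟩
  · rintro ⟨hz, h⟩
    exact ⟨hz, fun h' ↦ h'.2 h⟩

/-! ### The differential equation of `℘_Λ(u)` -/

/-- **The differential equation of `x = ℘_Λ(u)`**: off the poles,
`x′(z)² = u′(z)² · (4x(z)³ − g₂x(z) − g₃)` with `u′ = 2πi f` — the chain rule and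
`℘′² = 4℘³ − g₂℘ − g₃`; equivalently `(θx)² = f²(4x³ − g₂x − g₃)`, `θ = (2πi)⁻¹d/dz`
(Cremona 1997, §2.10: `x = ℘(u)`, `y = ℘′(u)` parametrise `Y² = 4X³ − g₂X − g₃` with
`dX/Y = du = 2πi f dτ`). [cite: CremonaAlgorithms1997, §2.10] -/
theorem deriv_weierstrassP_eichlerIntegral_sq {z : ℂ} (hz : 0 < z.im)
    (hzΛ : eichlerIntegral f (ofComplex z) ∉ L.lattice) :
    deriv (fun w : ℂ ↦ ℘[L] (eichlerIntegral f (ofComplex w))) z ^ 2 =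
      deriv (fun w : ℂ ↦ eichlerIntegral f (ofComplex w)) z ^ 2 *
        (4 * ℘[L] (eichlerIntegral f (ofComplex z)) ^ 3 -
          L.g₂ * ℘[L] (eichlerIntegral f (ofComplex z)) - L.g₃) := by
  have hu := hasDerivAt_eichlerIntegral f hz
  have h℘ := L.hasDerivAt_weierstrassP hzΛ
  have hcomp : HasDerivAt (fun w : ℂ ↦ ℘[L] (eichlerIntegral f (ofComplex w)))
      (℘'[L] (eichlerIntegral f (ofComplex z)) * (2 * π * Complex.I * f (ofComplex z))) z :=
    HasDerivAt.comp (h₂ := ℘[L]) (h := fun w : ℂ ↦ eichlerIntegral f (ofComplex w)) z h℘ hu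
  rw [hcomp.deriv, hu.deriv, mul_pow, L.derivWeierstrassP_sq _ hzΛ]
  ring

/-- The same equation in the normalised form used by `PeriodPair.exists_eq_weierstrassP_of_deriv_sq`
(solutions of `w′² = v′²(4w³ − g₂w − g₃)`), with `w = ℘_Λ ∘ u` and `v = u`: it holds on the
open set `{im z > 0, u(z) ∉ Λ}`. [folklore] -/
theorem deriv_weierstrassP_eichlerIntegral_sq_on :
    ∀ z ∈ {z : ℂ | 0 < z.im ∧ eichlerIntegral f (ofComplex z) ∉ L.lattice},
      deriv (fun w : ℂ ↦ ℘[L] (eichlerIntegral f (ofComplex w))) z ^ 2 =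
        deriv (fun w : ℂ ↦ eichlerIntegral f (ofComplex w)) z ^ 2 *
          (4 * ℘[L] (eichlerIntegral f (ofComplex z)) ^ 3 -
            L.g₂ * ℘[L] (eichlerIntegral f (ofComplex z)) - L.g₃) :=
  fun _ hz ↦ deriv_weierstrassP_eichlerIntegral_sq f L hz.1 hz.2

/-- `x = ℘_Λ ∘ u` is analytic off its poles. [folklore] -/
theorem analyticOnNhd_weierstrassP_eichlerIntegral :
    AnalyticOnNhd ℂ (fun w : ℂ ↦ ℘[L] (eichlerIntegral f (ofComplex w)))
      {z : ℂ | 0 < z.im ∧ eichlerIntegral f (ofComplex z) ∉ L.lattice} :=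
  fun _ hz ↦ AnalyticAt.comp (g := ℘[L]) (f := fun w : ℂ ↦ eichlerIntegral f (ofComplex w))
    (L.analyticOnNhd_weierstrassP _ hz.2) (analyticAt_eichlerIntegral_comp_ofComplex f hz.1)

end Literature.NumberTheory.EllipticCurves.ModularForms

end
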